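import Literature.AnabelianGeometry.EtaleTheta.Discharge.Sec1ZNTransportOfSplitting
import Literature.AnabelianGeometry.EtaleTheta.Discharge.Sec1InversionAutTransport
import HarnessLib

/-!
# [EtTh] §1 pp. 13–14 / Thm. 1.6 (iii): lifted splittings over `G_{K_N}` FROM A CUSP SECTION, and the
# K3 end-knit with the covering binders hYN / hZN eliminated in favour of origin clauses

Mochizuki, *The étale theta function and its Frobenioid-theoretic manifestations*, Publ. RIMS **45**
(2009), §1 p. 13 "any decomposition group of a cusp of `Y^log` determines, up to conjugation by
`(Δ^tp_Y)^ell`, a section `G_K → (Π^tp_Y)^ell` of the natural surjection `(Π^tp_Y)^ell ↠ G_K` whose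
restriction to the open subgroup `G_{K_N} ⊆ G_K` determines an open immersion
`G_{K_N} ↪ (Π^tp_Y)^ell/N·(Δ^tp_Y)^ell`" [cite: MochizukiEtTh2009, §1 p.13]; p. 14 "we have an exact
sequence `1 → Δ_Θ ⊗ ℤ/Nℤ → (Π^tp_{Y_N})^Θ/N·(Δ^tp_Y)^Θ → G_{K_N} → 1` [cf. the construction of `Y_N`]. Since
any two splittings of this exact sequence differ by a cohomology class …" [cite: MochizukiEtTh2009, §1 p.14];
Thm. 1.6 (iii) p. 25 [cite: MochizukiEtTh2009, Thm 1.6 (iii) p.25].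

abc-iut cell, layer L2, seat abc-iut-L2-t1 (§1 ROOT owner, gen 6). PROOF-ONLY companion (no definition,
no `Prop`-valued definition, no new named fact) of `Sec1ZNTransportOfSplitting.lean` (p454350, this
seat), of abc-iut-L6-d5's `Thm16SubdagAssembly.lean` (p418748: `map_GtpYN_eq_of_inputs`) and of the gen-5
capstone bridge `Sec1InversionAutTransport.lean` (p445347: `Thm16Sub.thm16iii_of_prop15iiiInv`), all
consumed BY NAME. Section conventions as in abc-iut-w5-d029's `ThetaCohomologyCuspSectionPoints.lean`
(p443548): a Galois section is `s : G_{ℚ_p} →* Π^tp_X` with `aug (s g) = g` on the relevant Galois group.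

* **`Thm16Sub.isThetaSplittingAt_of_cuspSection`** — granted the construction of `Y_N` from a cusp
  (`GtpYNFromCusp D N`, R2) and ONE Galois section `s : G_K → D_c` into a cuspidal decomposition group
  `D_c ≤ Π^tp_Y` (the `K`-rational cusp of `X`), the map `σ ↦ (s σ)^Θ` on `G_{K_N}` is a lifted splitting of
  `(Π^tp_{Y_N})^Θ/N·(Δ^tp_Y)^Θ ↠ G_{K_N}` (`ThetaSetting.IsThetaSplittingAt`, multiplicative on the nose):
  `s σ ∈ Π^tp_{Y_N}` for `σ ∈ G_{K_N}` by R2's ell-image clause. Hence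
  `Thm16Sub.exists_thetaSplittingAt_of_cuspSection` — the binder "a lifted splitting exists" of
  `map_GtpZN_eq_of_splitting` / `isInversionAut_of_originClauses` is DISCHARGED to R2 + a cusp section;
* `ThetaSetting.isInversionAut_of_originClauses_of_cuspSection` — `IsInversionAut ι` for an automorphism
  over `K` acting by `−1` on `Z` and `(Δ^tp_X)^ell`, from the clauses R2 / `GtpZNFromSplitting` at every
  level, [SemiAnbd] Thm. 6.5 (iii), a theta companion and one cusp section (no splitting binder left);
* **`Thm16Sub.thm16iii_of_prop15iiiInv_of_originClauses`** — [EtTh] Thm. 1.6 (iii) as in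
  `thm16iii_of_prop15iiiInv` with the covering binders hYN (`∀ N, γ(Π^tp_{Y_N,α}) = Π^tp_{Y_N,β}`) and hZN
  (`∀ N, γ(Π^tp_{Z_N,α}) = Π^tp_{Z_N,β}`) ELIMINATED in favour of: `γ(Π^tp_{Yα}) = Π^tp_{Yβ}` (leaf L02),
  the `G_{K_N}`- and `G_{J_N}`-membership transports (leaf L04 and its `J_N`-twin), R2 on both sides at
  every level, [SemiAnbd] Thm. 6.5 (iii), a cuspidal decomposition group inside `Π^tp_{Yα}`,
  `GtpZNFromSplitting` on both sides at every level and lifted splittings on the `α` side; and the variant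
  `…_of_cuspSection` where the last binder is a single cusp section on the `α` side.

HONEST FRAMING: [EtTh] is refereed; nothing asserted; the clauses stay named hypotheses; typed ≠ proved;
nothing here bears on [IUTchIII] Cor. 3.12.
-/

noncomputable section

namespace Literature.AnabelianGeometry.EtaleTheta

open Literature.AnabelianGeometry.SemiGraphs

namespace Thm16Sub

variable {p : ℕ} [Fact p.Prime]

/-! ### Lifted splittings over `G_{K_N}` from a cusp section -/

section CuspSection

variable (D : ThetaSetting p) {Dc : Subgroup D.PiTemp} (hDc : D.IsCuspidalDecompositionGroup Dc)
  (hDcY : Dc ≤ D.GtpY) (s : GQp p →* D.PiTemp) (hsec : ∀ g : GQp p, g ∈ D.GK → D.aug (s g) = g)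
  (hsD : D.GK.map s ≤ Dc)

include hDc hDcY hsec hsD in
/-- A Galois section into a cuspidal decomposition group `D_c ≤ Π^tp_Y` takes `G_{K_N}` into `Π^tp_{Y_N}`,
granted the construction of `Y_N` from the cusp (R2, p. 13: the image of `G_{K_N}` in
`(Π^tp_Y)^ell/N·(Δ^tp_Y)^ell` cuts out `Y_N`). [cite: MochizukiEtTh2009, §1 p.13] -/
theorem section_mem_GtpYN_of_cuspSection (N : ℕ+) (hcusp : GtpYNFromCusp D N) {σ : GQp p}
    (hσ : σ ∈ D.GKN N) : s σ ∈ D.GtpYN N := by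
  have hσK : σ ∈ D.GK := D.GKN_le_GK N hσ
  have hsDc : s σ ∈ Dc := hsD ⟨σ, hσK, rfl⟩
  have haug : D.aug (s σ) ∈ D.GKN N := by rw [hsec σ hσK]; exact hσ
  rw [hcusp Dc hDc hDcY (s σ)]
  refine ⟨hDcY hsDc, haug, Subgroup.mem_sup_left ⟨s σ, ⟨hsDc, ?_⟩, rfl⟩⟩
  exact haug

include hDc hDcY hsec hsD in
/-- **A lifted splitting from a cusp section** (pp. 13–14): `σ ↦ (s σ)^Θ` on `G_{K_N}` is a lifted splitting
of `(Π^tp_{Y_N})^Θ/N·(Δ^tp_Y)^Θ ↠ G_{K_N}` — its values are images of elements of `Π^tp_{Y_N}` over `σ`, and it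
is multiplicative (on the nose). [cite: MochizukiEtTh2009, §1 p.14] -/
theorem isThetaSplittingAt_of_cuspSection (N : ℕ+) (hcusp : GtpYNFromCusp D N) :
    D.IsThetaSplittingAt N (fun σ : ↥(D.GKN N) => D.toTheta (s (σ : GQp p))) where
  exists_lift σ := ⟨s (σ : GQp p), section_mem_GtpYN_of_cuspSection D hDc hDcY s hsec hsD N hcusp σ.2,
    hsec _ (D.GKN_le_GK N σ.2), rfl⟩
  map_mul_mem σ τ := by
    have h : D.toTheta (s ((σ * τ : ↥(D.GKN N)) : GQp p)) *
        (D.toTheta (s (σ : GQp p)) * D.toTheta (s (τ : GQp p)))⁻¹ = 1 := by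
      rw [Subgroup.coe_mul, map_mul, map_mul, mul_inv_cancel]
    rw [h]
    exact Subgroup.one_mem _

include hDc hDcY hsec hsD in
/-- The binder "a lifted splitting over `G_{K_N}` exists" DISCHARGED to R2 + a cusp section.
[cite: MochizukiEtTh2009, §1 p.14] -/
theorem exists_thetaSplittingAt_of_cuspSection (N : ℕ+) (hcusp : GtpYNFromCusp D N) :
    ∃ t : ↥(D.GKN N) → D.GtpTheta, D.IsThetaSplittingAt N t :=
  ⟨_, isThetaSplittingAt_of_cuspSection D hDc hDcY s hsec hsD N hcusp⟩

end CuspSection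

/-! ### The K3 end-knit: Thm. 1.6 (iii) with hYN / hZN from origin clauses -/

section Knit

variable {Dα Dβ : ThetaSetting p} {γ : Dα.PiTemp ≃ₜ* Dβ.PiTemp}

/-- **[EtTh] Theorem 1.6 (iii) with the covering binders hYN / hZN ELIMINATED** (cf.
`thm16iii_of_prop15iiiInv`, p445347): `γ(Π^tp_{Y_N,α}) = Π^tp_{Y_N,β}` is L6-d5's `map_GtpYN_eq_of_inputs`
(from (hΔ), leaf L02 `hY`, leaf L04 `haugN`, R2 on both sides, [SemiAnbd] Thm. 6.5 (iii), a cuspidal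
decomposition group in `Π^tp_{Yα}`) and `γ(Π^tp_{Z_N,α}) = Π^tp_{Z_N,β}` is `map_GtpZN_eq_of_splitting` (from
the theta companion, the `G_{J_N}`-membership transport, `GtpZNFromSplitting` on both sides and lifted
splittings on the `α` side). All other inputs verbatim as in `thm16iii_of_prop15iiiInv`.
[cite: MochizukiEtTh2009, Thm 1.6 (iii) p.25] -/
theorem thm16iii_of_prop15iiiInv_of_originClauses (h : ThetaSetting.Thm16i γ)
    (c : ThetaSetting.ThetaCompanion γ)
    (hΔ : Dα.DeltaTemp.map γ.toMulEquiv.toMonoidHom = Dβ.DeltaTemp)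
    -- the covering clauses, from origin clauses
    (hY : Dα.GtpY.map γ.toMulEquiv.toMonoidHom = Dβ.GtpY)
    (haugN : ∀ (N : ℕ+) (g : Dα.PiTemp), Dβ.aug (γ.toMulEquiv g) ∈ Dβ.GKN N ↔ Dα.aug g ∈ Dα.GKN N)
    (haugJN : ∀ (N : ℕ+) (g : Dα.PiTemp), Dβ.aug (γ.toMulEquiv g) ∈ Dβ.GJN N ↔ Dα.aug g ∈ Dα.GJN N)
    (hcuspα : ∀ N, GtpYNFromCusp Dα N) (hcuspβ : ∀ N, GtpYNFromCusp Dβ N)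
    (h65 : Dα.IsoPreservesCuspidalDecomp Dβ.toTemperedCurve)
    (hex : ∃ Dc : Subgroup Dα.PiTemp, Dα.IsCuspidalDecompositionGroup Dc ∧ Dc ≤ Dα.GtpY)
    (hzα : ∀ N, Dα.GtpZNFromSplitting N) (hsα : ∀ N : ℕ+, ∃ t, Dα.IsThetaSplittingAt N t)
    (hzβ : ∀ N, Dβ.GtpZNFromSplitting N)
    -- the rest verbatim
    (Eα : Dα.EtaleThetaData) (Eβ : Dβ.EtaleThetaData) (hCα : Dα.Compat) (hCβ : Dβ.Compat)
    (hSβ : Dβ.Sec2Hyps) (h15iiα : ThetaSetting.Prop15ii Eα.toKummerData hCα)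
    (h15ii : ThetaSetting.Prop15ii Eβ.toKummerData hCβ)
    (h15α : ThetaSetting.Prop15iii Eα hCα) (h15β : ThetaSetting.Prop15iii Eβ hCβ)
    {σ : Dβ.PiTemp} (hσ : σ ∈ Dβ.GtpYdd)
    (Vα : ThetaSetting.ValuationHatData Dα Eα.toKummerData)
    (Vβ : ThetaSetting.ValuationHatData Dβ Eβ.toKummerData)
    (hVα : Vα.unitsHat = Dα.unitsOKdd.map Eα.toKddHat) (hVβ : Vβ.unitsHat = Dβ.unitsOKdd.map Eβ.toKddHat)
    (h16ii : ThetaSetting.Thm16ii γ h Eα.toKummerData Eβ.toKummerData Vα Vβ)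
    (hTβ : Dβ.HasThetaTopology) (hOβ : Dβ.IsEtThOrigin)
    {lamβ : ↥((Dβ.DtpYddN 1).map Dβ.toTheta) →ₜ* Dβ.DeltaTheta} (hstdβ : ThetaSetting.IsStdLog lamβ)
    (hresβ : ContH1.res (MonoidHom.id Dβ.GtpTheta) Dβ.DeltaTheta Dβ.map_toTheta_DtpYddN_one_le Eβ.logUdd =
      ThetaSetting.homClass ThetaSetting.dtpYddTheta_le_deltaTheta_map lamβ)
    {ια : Dα.PiTemp ≃ₜ* Dα.PiTemp} (hια : Dα.IsInversionAut ια) (cα : ThetaSetting.ThetaCompanion ια)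
    (hInvα : ThetaSetting.InvClauses Eα hια cα)
    (cβ : ThetaSetting.ThetaCompanion ((γ.symm.trans ια).trans γ))
    (h15invβ : Dβ.Prop15iiiInvAnchored Eβ)
    (yβ : ThetaSetting.CuspidalPointDd Eβ.toKummerData) (hyβA : yβ.IsAnchored) (hyβ0 : yβ.IsOnLabelZero)
    (hyβfix : Dβ.FixesCuspBelow ((γ.symm.trans ια).trans γ) yβ)
    (y : ThetaSetting.CuspidalPointDd Eβ.toKummerData) {u₁ u₂ v₁ v₂ : (↥Dβ.Kdd)ˣ}
    (hu₁ : u₁ ∈ Dβ.unitsOKdd) (hu₂ : u₂ ∈ Dβ.unitsOKdd)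
    (hv : ‖((v₁ : Dβ.Kdd) : PadicAlgCl p)‖ = ‖((v₂ : Dβ.Kdd) : PadicAlgCl p)‖)
    (h₁ : haveI := hCβ.GtpYdd_normal
      y.evalAt (ContH1.res Dβ.toTheta Dβ.DeltaTheta (y.sec_le.trans y.Dpt_le)
        (ContH1.conj Dβ.toTheta Dβ.DeltaTheta σ Eβ.etaDd)) = Eβ.toKddHat (u₁ * v₁))
    (h₂ : y.evalAt (ContH1.res Dβ.toTheta Dβ.DeltaTheta (y.sec_le.trans y.Dpt_le)
        (ThetaSetting.transport c h Eα.etaDd)) = Eβ.toKddHat (u₂ * v₂)) :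
    ThetaSetting.Thm16iii γ h c Eα Eβ hCβ :=
  have hYN : ∀ N, (Dα.GtpYN N).map γ.toMulEquiv.toMonoidHom = Dβ.GtpYN N := fun N =>
    map_GtpYN_eq_of_inputs Dα Dβ γ hΔ N hY (haugN N) (hcuspα N) (hcuspβ N) h65 hex
  have hZN : ∀ N, (Dα.GtpZN N).map γ.toMulEquiv.toMonoidHom = Dβ.GtpZN N := fun N =>
    map_GtpZN_eq_of_splitting Dα Dβ γ hΔ N c hY (hYN N) (haugN N) (haugJN N) (hzα N) (hsα N) (hzβ N)
  thm16iii_of_prop15iiiInv h c hΔ hYN hZN Eα Eβ hCα hCβ hSβ h15iiα h15ii h15α h15β hσ Vα Vβ hVα hVβ h16ii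
    hTβ hOβ hstdβ hresβ hια cα hInvα cβ h15invβ yβ hyβA hyβ0 hyβfix y hu₁ hu₂ hv h₁ h₂

/-- **The same with the `α`-side splittings from ONE cusp section** `s : G_{Kα} → D_c ≤ Π^tp_{Yα}`
(which also supplies the cuspidal decomposition group inside `Π^tp_{Yα}`).
[cite: MochizukiEtTh2009, Thm 1.6 (iii) p.25] -/
theorem thm16iii_of_prop15iiiInv_of_cuspSection (h : ThetaSetting.Thm16i γ)
    (c : ThetaSetting.ThetaCompanion γ)
    (hΔ : Dα.DeltaTemp.map γ.toMulEquiv.toMonoidHom = Dβ.DeltaTemp)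
    (hY : Dα.GtpY.map γ.toMulEquiv.toMonoidHom = Dβ.GtpY)
    (haugN : ∀ (N : ℕ+) (g : Dα.PiTemp), Dβ.aug (γ.toMulEquiv g) ∈ Dβ.GKN N ↔ Dα.aug g ∈ Dα.GKN N)
    (haugJN : ∀ (N : ℕ+) (g : Dα.PiTemp), Dβ.aug (γ.toMulEquiv g) ∈ Dβ.GJN N ↔ Dα.aug g ∈ Dα.GJN N)
    (hcuspα : ∀ N, GtpYNFromCusp Dα N) (hcuspβ : ∀ N, GtpYNFromCusp Dβ N)
    (h65 : Dα.IsoPreservesCuspidalDecomp Dβ.toTemperedCurve)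
    {Dc : Subgroup Dα.PiTemp} (hDc : Dα.IsCuspidalDecompositionGroup Dc) (hDcY : Dc ≤ Dα.GtpY)
    (s : GQp p →* Dα.PiTemp) (hsec : ∀ g : GQp p, g ∈ Dα.GK → Dα.aug (s g) = g) (hsD : Dα.GK.map s ≤ Dc)
    (hzα : ∀ N, Dα.GtpZNFromSplitting N) (hzβ : ∀ N, Dβ.GtpZNFromSplitting N)
    (Eα : Dα.EtaleThetaData) (Eβ : Dβ.EtaleThetaData) (hCα : Dα.Compat) (hCβ : Dβ.Compat)
    (hSβ : Dβ.Sec2Hyps) (h15iiα : ThetaSetting.Prop15ii Eα.toKummerData hCα)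
    (h15ii : ThetaSetting.Prop15ii Eβ.toKummerData hCβ)
    (h15α : ThetaSetting.Prop15iii Eα hCα) (h15β : ThetaSetting.Prop15iii Eβ hCβ)
    {σ : Dβ.PiTemp} (hσ : σ ∈ Dβ.GtpYdd)
    (Vα : ThetaSetting.ValuationHatData Dα Eα.toKummerData)
    (Vβ : ThetaSetting.ValuationHatData Dβ Eβ.toKummerData)
    (hVα : Vα.unitsHat = Dα.unitsOKdd.map Eα.toKddHat) (hVβ : Vβ.unitsHat = Dβ.unitsOKdd.map Eβ.toKddHat)
    (h16ii : ThetaSetting.Thm16ii γ h Eα.toKummerData Eβ.toKummerData Vα Vβ)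
    (hTβ : Dβ.HasThetaTopology) (hOβ : Dβ.IsEtThOrigin)
    {lamβ : ↥((Dβ.DtpYddN 1).map Dβ.toTheta) →ₜ* Dβ.DeltaTheta} (hstdβ : ThetaSetting.IsStdLog lamβ)
    (hresβ : ContH1.res (MonoidHom.id Dβ.GtpTheta) Dβ.DeltaTheta Dβ.map_toTheta_DtpYddN_one_le Eβ.logUdd =
      ThetaSetting.homClass ThetaSetting.dtpYddTheta_le_deltaTheta_map lamβ)
    {ια : Dα.PiTemp ≃ₜ* Dα.PiTemp} (hια : Dα.IsInversionAut ια) (cα : ThetaSetting.ThetaCompanion ια)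
    (hInvα : ThetaSetting.InvClauses Eα hια cα)
    (cβ : ThetaSetting.ThetaCompanion ((γ.symm.trans ια).trans γ))
    (h15invβ : Dβ.Prop15iiiInvAnchored Eβ)
    (yβ : ThetaSetting.CuspidalPointDd Eβ.toKummerData) (hyβA : yβ.IsAnchored) (hyβ0 : yβ.IsOnLabelZero)
    (hyβfix : Dβ.FixesCuspBelow ((γ.symm.trans ια).trans γ) yβ)
    (y : ThetaSetting.CuspidalPointDd Eβ.toKummerData) {u₁ u₂ v₁ v₂ : (↥Dβ.Kdd)ˣ}
    (hu₁ : u₁ ∈ Dβ.unitsOKdd) (hu₂ : u₂ ∈ Dβ.unitsOKdd)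
    (hv : ‖((v₁ : Dβ.Kdd) : PadicAlgCl p)‖ = ‖((v₂ : Dβ.Kdd) : PadicAlgCl p)‖)
    (h₁ : haveI := hCβ.GtpYdd_normal
      y.evalAt (ContH1.res Dβ.toTheta Dβ.DeltaTheta (y.sec_le.trans y.Dpt_le)
        (ContH1.conj Dβ.toTheta Dβ.DeltaTheta σ Eβ.etaDd)) = Eβ.toKddHat (u₁ * v₁))
    (h₂ : y.evalAt (ContH1.res Dβ.toTheta Dβ.DeltaTheta (y.sec_le.trans y.Dpt_le)
        (ThetaSetting.transport c h Eα.etaDd)) = Eβ.toKddHat (u₂ * v₂)) :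
    ThetaSetting.Thm16iii γ h c Eα Eβ hCβ :=
  thm16iii_of_prop15iiiInv_of_originClauses h c hΔ hY haugN haugJN hcuspα hcuspβ h65 ⟨Dc, hDc, hDcY⟩ hzα
    (fun N => exists_thetaSplittingAt_of_cuspSection Dα hDc hDcY s hsec hsD N (hcuspα N)) hzβ Eα Eβ hCα hCβ
    hSβ h15iiα h15ii h15α h15β hσ Vα Vβ hVα hVβ h16ii hTβ hOβ hstdβ hresβ hια cα hInvα cβ h15invβ yβ hyβA hyβ0
    hyβfix y hu₁ hu₂ hv h₁ h₂

end Knit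

end Thm16Sub

namespace ThetaSetting

variable {p : ℕ} [Fact p.Prime] (D : ThetaSetting p) (ι : D.PiTemp ≃ₜ* D.PiTemp)

/-- **`IsInversionAut` from origin clauses and ONE cusp section** (Prop. 1.5 (iii) p. 23; pp. 13–14): as
`isInversionAut_of_originClauses`, the binders "a cuspidal decomposition group inside `Π^tp_Y`" and
"lifted splittings exist at every level" both supplied by a Galois section `s : G_K → D_c` into a cuspidal
decomposition group `D_c ≤ Π^tp_Y`. [cite: MochizukiEtTh2009, Prop 1.5 (iii) p.23] -/
theorem isInversionAut_of_originClauses_of_cuspSection (c : ThetaCompanion ι)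
    (haug : ∀ g : D.PiTemp, D.aug (ι g) = D.aug g)
    (htoZ : ∀ g : D.PiTemp, D.toZ (ι g) = (D.toZ g)⁻¹)
    (hell : ∀ g ∈ D.DeltaTemp, D.thetaToEll (D.toTheta (ι g)) = (D.thetaToEll (D.toTheta g))⁻¹)
    (hcusp : ∀ N, Thm16Sub.GtpYNFromCusp D N) (h65 : D.IsoPreservesCuspidalDecomp D.toTemperedCurve)
    {Dc : Subgroup D.PiTemp} (hDc : D.IsCuspidalDecompositionGroup Dc) (hDcY : Dc ≤ D.GtpY)
    (s : GQp p →* D.PiTemp) (hsec : ∀ g : GQp p, g ∈ D.GK → D.aug (s g) = g) (hsD : D.GK.map s ≤ Dc)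
    (hz : ∀ N, D.GtpZNFromSplitting N) :
    D.IsInversionAut ι :=
  D.isInversionAut_of_originClauses ι c haug htoZ hell hcusp h65 ⟨Dc, hDc, hDcY⟩ hz fun N =>
    Thm16Sub.exists_thetaSplittingAt_of_cuspSection D hDc hDcY s hsec hsD N (hcusp N)

end ThetaSetting

end Literature.AnabelianGeometry.EtaleTheta

end
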